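import Summits.BirchSwinnertonDyer.BirchSwinnertonDyer.Theorems.KolyvaginRoadThreeSchneiderTamAtThreeHeightLogNumeratorSecondOrderSeries
import HarnessLib

/-!
# Crux `SchneiderTamAtThree` (item 19154) — THE HEIGHT IS THE LOGARITHM OF THE NUMERATOR, SECOND ORDER,
# part 2a/3: the algebraic core of the main theorem (exact polynomial identity + coefficient table)

HONEST FRAMING (cell `bsd-stepL`, seat `bsd-stepL-tam3-p2` g2, WIDTH-LEVER second lane «closed-form Schneider
local factor at 3 … finite case table proved once»; `--supports stmt-BirchSwinnertonDyer-19154 --as helper`):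
THEOREMS ONLY, unconditional, route-independent (no Theses import); 0 definitions, 0 named facts, 0 sorry;
nothing here proves the crux `SchneiderTamAtThree`, Schneider's conjecture or BSD.

* `second_order_poly_bound` — the EXACT polynomial identity behind the second `3`-adic digit:
  with `β = ⅓(a₁²+a₂)`, `S = 1 + ½a₁z + βz²`, `P = (1 − a₁z − a₂z²)S²`, `λ = Cz²/12`, `μ = C²z⁴/360`,
  `κ = (C − b₂)/12` (`C` standing for `C⁻²` of the uniformisation, `C ≡ b₂ mod 3`):
  `P + λ(1 + a₁z + 4βz²) + μ − 1 − κz² = A₃z³ + A₄z⁴ + P₅z⁵ + P₆z⁶` with `‖A₃‖ ≤ 1`, `‖A₄‖ ≤ 3`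
  (the mod-3 cancellation `(a₁²+a₂)² + (a₁²+a₂)C + C²/40 ≡ 0`), `‖P₅‖, ‖P₆‖ ≤ 9`, whence
  `‖…‖ ≤ ‖z‖²/3` for `‖z‖ ≤ 3⁻¹`.
* `second_order_core_bound` — the same for the analytic expression
  `(1+π)(1+σ)²(1 + λ(1+σ)² + μ(1+σ)⁴)` (`= x·C²·(L + L²/12 + L³/360)` in part 2b), given the equation
  to third order `π = −a₁z − a₂z² + O(z³)` and the formal logarithm to third order
  `σ = ½a₁z + ⅓(a₁²+a₂)z² + O(z³)`.
The main theorem `‖x·Σ²_E(P) − 1 + (b₂b₄/c₄)·x⁻¹‖₃ ≤ 3⁻¹‖x‖₃⁻¹` is part 2b (`…SecondOrder.lean`).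

Overview of the proof of the main theorem, parts 2a + 2b (`z = −x/y`, `r = ‖z‖ = 3^{−k}`, `ℓ = log_W z = z(1+σ)`, `x z² = 1 + π`, `C2 = C²`, `L = ℓ²/C2`,
`λ = z²/(12C2)`, `μ = z⁴/(360C2²)`, `Σ² = C2·2(ch L − 1)·Π`): (a) `Π = 1 + O(r²/3)` (`‖q‖ ≤ 3⁻¹`);
(b) `2(ch L − 1) = L + L²/12 + L³/360 + O(9r⁸)` (part 1); (c) hence `x·Σ² ≡ M₃ :=
(1+π)(1+σ)²·(1 + λ(1+σ)² + μ(1+σ)⁴)`; (d) `π = −a₁z − a₂z² + O(r³)` (equation to third order, part 1),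
`σ = ½a₁z + ⅓(a₁²+a₂)z² + O(r³)` (formal logarithm to third order); (e) modulo terms of norm `≤ r²/3`,
`M₃ ≡ P(z) + λ(1 + a₁z + 4βz²) + μ` with `P = (1 − a₁z − a₂z²)(1 + ½a₁z + βz²)²`, `β = ⅓(a₁²+a₂)`, and the
EXACT polynomial identity `P + λ(1 + a₁z + 4βz²) + μ − 1 − κz² = A₃z³ + A₄z⁴ + P₅z⁵ + P₆z⁶`,
`κ = (C⁻² − b₂)/12`, whose coefficients satisfy `‖A₃‖ ≤ 1` (by `C⁻² ≡ b₂`), `‖A₄‖ ≤ 3` (the mod-3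
cancellation `9A₄ = (3β − C⁻²)² + 3(…) − (39/40)C⁻⁴`), `‖P₅‖, ‖P₆‖ ≤ 9`; (f) `κ ≡ −b₂b₄/c₄ (mod 3)` (part 1)
and `z² ≡ x⁻¹ (mod r³)`.

References: [SteinWuthrich2013] §4.1 (4.1), §4.2; [SilvermanAEC2009] IV.1, IV.5–6, VII.2; [MazurTate1991]
(the `σ`-function; here only through the tree's transcription); tree: parts 1–3 of the first-order chain.
-/

noncomputable section

open scoped Classical Nat
open Filter Topology IsUltrametricDist PowerSeries
open WeierstrassCurve Literature.NumberTheory.EllipticCurves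
open Literature.NumberTheory.EllipticCurves.SteinWuthrich2013
open Literature.NumberTheory.EllipticCurves.TateCurve
open Literature.NumberTheory.EllipticCurves.Rank1Residual
open Summit.BirchSwinnertonDyer.Uniform.UI.O2

namespace Summit.BirchSwinnertonDyer.Rank1Residual.X11b.RegMult.HeightLogNumerator

/-! ### §4 Numerics and `3`-adic constants -/

section Aux

/-- Small real-number facts about `r = ‖z‖ ∈ (0, 1/3]` used in the second-order bookkeeping. [folklore] -/
theorem second_order_numerics (r : ℝ) (h0 : 0 < r) (h3 : r ≤ 1 / 3) :
    r ≤ 1 ∧ r ^ 2 ≤ 1 ∧ r ^ 2 ≤ 1 / 9 ∧ r ^ 2 < r ∧ 3 * r ^ 2 ≤ r ∧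
      r ^ 3 ≤ r ^ 2 / 3 ∧ 3 * r ^ 4 ≤ r ^ 2 / 3 ∧ 9 * r ^ 5 ≤ r ^ 2 / 3 ∧ 9 * r ^ 6 ≤ r ^ 2 / 3 := by
  have h9 : r ^ 2 ≤ 1 / 9 := by nlinarith
  have hr3 : r ^ 3 ≤ r ^ 2 / 3 := by nlinarith [sq_nonneg r]
  refine ⟨by linarith, by nlinarith, h9, by nlinarith, by nlinarith, hr3, by nlinarith, ?_, ?_⟩
  · have : r ^ 3 ≤ 1 / 27 := by nlinarith
    nlinarith [sq_nonneg r]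
  · have : r ^ 4 ≤ 1 / 81 := by nlinarith
    nlinarith [sq_nonneg r]

/-- More small facts about `r = ‖z‖ ∈ (0, 1/3]` (kept out of the heavy context of the main proof). [folklore] -/
theorem second_order_numerics' (r : ℝ) (h0 : 0 < r) (h3 : r ≤ 1 / 3) :
    r ^ 3 ≤ r ∧ r ^ 3 ≤ r ^ 2 ∧ r ^ 2 / 3 ≤ 1 ∧ r ^ 3 ≤ 1 := by
  have h1 : r ≤ 1 := by linarith
  have h2 : r ^ 2 ≤ 1 := by nlinarith
  refine ⟨by nlinarith, by nlinarith, by nlinarith, by nlinarith⟩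


/-- `3`-adic norms of the constants `2, 4, 3⁻¹, 9⁻¹, 12⁻¹, 360⁻¹`. [folklore] -/
theorem padic_three_constants :
    ‖(2 : ℚ_[3])‖ = 1 ∧ ‖(4 : ℚ_[3])‖ = 1 ∧ ‖(3 : ℚ_[3])‖ = 1 / 3 ∧ ‖(3 : ℚ_[3])⁻¹‖ = 3 ∧
      ‖(9 : ℚ_[3])⁻¹‖ = 9 ∧ ‖(12 : ℚ_[3])⁻¹‖ = 3 ∧ ‖(360 : ℚ_[3])⁻¹‖ = 9 ∧ ‖(6 : ℚ_[3])‖ ≤ 1 / 3 ∧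
      ‖(9 : ℚ_[3])‖ ≤ 1 / 3 ∧ ‖(39 / 40 : ℚ_[3])‖ ≤ 1 / 3 := by
  have h2n : ‖(2 : ℚ_[3])‖ = 1 := by
    simpa using Padic.norm_natCast_eq_one_iff.mpr (show Nat.Coprime 3 2 by decide)
  have h4n : ‖(4 : ℚ_[3])‖ = 1 := by
    simpa using Padic.norm_natCast_eq_one_iff.mpr (show Nat.Coprime 3 4 by decide)
  have h40 : ‖(40 : ℚ_[3])‖ = 1 := by
    simpa using Padic.norm_natCast_eq_one_iff.mpr (show Nat.Coprime 3 40 by decide)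
  have h13 : ‖(13 : ℚ_[3])‖ = 1 := by
    simpa using Padic.norm_natCast_eq_one_iff.mpr (show Nat.Coprime 3 13 by decide)
  have h3n : ‖(3 : ℚ_[3])‖ = 1 / 3 := by
    rw [show (3 : ℚ_[3]) = ((3 : ℕ) : ℚ_[3]) by norm_cast, Padic.norm_p]; norm_num
  have h3i : ‖(3 : ℚ_[3])⁻¹‖ = 3 := by rw [norm_inv, h3n]; norm_num
  have h9i : ‖(9 : ℚ_[3])⁻¹‖ = 9 := by
    rw [show (9 : ℚ_[3]) = 3 * 3 by norm_num, mul_inv, norm_mul, h3i]; norm_num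
  refine ⟨h2n, h4n, h3n, h3i, h9i, ?_, ?_, ?_, ?_, ?_⟩
  · rw [show (12 : ℚ_[3]) = 4 * 3 by norm_num, mul_inv, norm_mul, h3i, norm_inv, h4n]; norm_num
  · rw [show (360 : ℚ_[3]) = 40 * 9 by norm_num, mul_inv, norm_mul, h9i, norm_inv, h40]; norm_num
  · rw [show (6 : ℚ_[3]) = 2 * 3 by norm_num, norm_mul, h2n, h3n]; norm_num
  · rw [show (9 : ℚ_[3]) = 3 * 3 by norm_num, norm_mul, h3n]; norm_num
  · rw [norm_div, h40, div_one, show (39 : ℚ_[3]) = 13 * 3 by norm_num, norm_mul, h3n, h13]; norm_num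

end Aux

/-! ### §5 The algebraic core: an exact polynomial identity and its coefficient table -/

section Core

/-- **The polynomial core of the second-order law.** For `a₁, a₂, C, z ∈ ℚ₃` with `‖a₁‖, ‖a₂‖ ≤ 1`,
`‖C‖ = 1`, `C ≡ b₂ = a₁² + 4a₂ (mod 3)` and `0 < ‖z‖ ≤ 3⁻¹`: with `β = ⅓(a₁² + a₂)`,
`S = 1 + ½a₁z + βz²`, `P = (1 − a₁z − a₂z²)S²`, `λ = Cz²/12`, `μ = C²z⁴/360`, `κ = (C − b₂)/12`,
`‖P + λ(1 + a₁z + 4βz²) + μ − 1 − κz²‖ ≤ ‖z‖²/3`. Proof: the EXACT identity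
`P + λ(1 + a₁z + 4βz²) + μ − 1 − κz² = A₃z³ + A₄z⁴ + P₅z⁵ + P₆z⁶` with
`A₃ = a₁((C − b₂ − 3a₁²)/12 − a₁²/4 − a₂)` (`‖A₃‖ ≤ 1`),
`9A₄ = (a₁² + a₂ − C)² + 3(a₁²+a₂)C − (39/40)C² − 3a₁²(a₁²+a₂) − 6a₂(a₁²+a₂) − 9a₁²a₂/4`
(`‖A₄‖ ≤ 3`: every summand is `≡ 0 mod 3` since `a₁² + a₂ ≡ b₂ ≡ C`), `P₅ = −a₁β² − a₁a₂β`,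
`P₆ = −a₂β²` (`‖·‖ ≤ 9`), and `r³, 3r⁴, 9r⁵, 9r⁶ ≤ r²/3` for `r ≤ 3⁻¹`. (Here `C` plays `C⁻²` of the
uniformisation.) [folklore] -/
theorem second_order_poly_bound {a₁ a₂ C z : ℚ_[3]} (ha1 : ‖a₁‖ ≤ 1) (ha2 : ‖a₂‖ ≤ 1) (hC : ‖C‖ = 1)
    (hCb : ‖C - (a₁ ^ 2 + 4 * a₂)‖ ≤ 1 / 3) (hzz : 0 < ‖z‖) (hz3 : ‖z‖ ≤ 1 / 3) :
    ‖(1 - a₁ * z - a₂ * z ^ 2) * (1 + (2 : ℚ_[3])⁻¹ * a₁ * z + (3 : ℚ_[3])⁻¹ * (a₁ ^ 2 + a₂) * z ^ 2) ^ 2 +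
        (12 : ℚ_[3])⁻¹ * C * z ^ 2 * (1 + a₁ * z + 4 * ((3 : ℚ_[3])⁻¹ * (a₁ ^ 2 + a₂)) * z ^ 2) +
        (360 : ℚ_[3])⁻¹ * C ^ 2 * z ^ 4 - 1 - (C - (a₁ ^ 2 + 4 * a₂)) / 12 * z ^ 2‖ ≤ ‖z‖ ^ 2 / 3 := by
  obtain ⟨hz1, -, -, -, -, hr3, hr4, hr5, hr6⟩ := second_order_numerics ‖z‖ hzz hz3
  obtain ⟨h2n, h4n, h3n, h3i, h9i, h12i, -, h6, h9n, h39⟩ := padic_three_constants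
  set β : ℚ_[3] := (3 : ℚ_[3])⁻¹ * (a₁ ^ 2 + a₂) with hβdef
  have ha12 : ‖a₁ ^ 2 + a₂‖ ≤ 1 :=
    (norm_add_le_max _ _).trans (max_le (by rw [norm_pow]; exact pow_le_one₀ (norm_nonneg _) ha1) ha2)
  have hβ : ‖β‖ ≤ 3 := by
    rw [hβdef, norm_mul, h3i]
    calc 3 * ‖a₁ ^ 2 + a₂‖ ≤ 3 * 1 := by gcongr
      _ = 3 := mul_one _
  set A₃ : ℚ_[3] := a₁ * ((12 : ℚ_[3])⁻¹ * ((C - (a₁ ^ 2 + 4 * a₂)) - 3 * a₁ ^ 2) - a₁ ^ 2 / 4 - a₂)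
    with hA₃def
  set A₄ : ℚ_[3] := (9 : ℚ_[3])⁻¹ * (((a₁ ^ 2 + a₂) - C) ^ 2 + 3 * (a₁ ^ 2 + a₂) * C -
      39 / 40 * C ^ 2 - 3 * a₁ ^ 2 * (a₁ ^ 2 + a₂) - 6 * a₂ * (a₁ ^ 2 + a₂) - 9 * a₁ ^ 2 * a₂ / 4)
    with hA₄def
  set P₅ : ℚ_[3] := -(a₁ * β ^ 2) - a₁ * a₂ * β with hP₅def
  set P₆ : ℚ_[3] := -(a₂ * β ^ 2) with hP₆def
  have hpoly : (1 - a₁ * z - a₂ * z ^ 2) * (1 + (2 : ℚ_[3])⁻¹ * a₁ * z + (3 : ℚ_[3])⁻¹ * (a₁ ^ 2 + a₂) *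
        z ^ 2) ^ 2 + (12 : ℚ_[3])⁻¹ * C * z ^ 2 * (1 + a₁ * z + 4 * ((3 : ℚ_[3])⁻¹ * (a₁ ^ 2 + a₂)) *
        z ^ 2) + (360 : ℚ_[3])⁻¹ * C ^ 2 * z ^ 4 - 1 - (C - (a₁ ^ 2 + 4 * a₂)) / 12 * z ^ 2 =
      A₃ * z ^ 3 + A₄ * z ^ 4 + P₅ * z ^ 5 + P₆ * z ^ 6 := by
    rw [hA₃def, hA₄def, hP₅def, hP₆def, hβdef]
    ring
  rw [hpoly]
  have hA₃ : ‖A₃‖ ≤ 1 := by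
    rw [hA₃def, norm_mul]
    have hin : ‖(12 : ℚ_[3])⁻¹ * ((C - (a₁ ^ 2 + 4 * a₂)) - 3 * a₁ ^ 2) - a₁ ^ 2 / 4 - a₂‖ ≤ 1 := by
      refine (norm_sub_le_max₃ _ _).trans (max_le ((norm_sub_le_max₃ _ _).trans (max_le ?_ ?_)) ha2)
      · rw [norm_mul, h12i]
        have : ‖(C - (a₁ ^ 2 + 4 * a₂)) - 3 * a₁ ^ 2‖ ≤ 1 / 3 := by
          refine (norm_sub_le_max₃ _ _).trans (max_le hCb ?_)
          rw [norm_mul, h3n, norm_pow]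
          calc (1 / 3 : ℝ) * ‖a₁‖ ^ 2 ≤ (1 / 3) * 1 ^ 2 := by gcongr
            _ = 1 / 3 := by norm_num
        calc 3 * ‖(C - (a₁ ^ 2 + 4 * a₂)) - 3 * a₁ ^ 2‖ ≤ 3 * (1 / 3) := by gcongr
          _ = 1 := by norm_num
      · rw [norm_div, h4n, div_one, norm_pow]; exact pow_le_one₀ (norm_nonneg _) ha1
    exact (mul_le_mul ha1 hin (norm_nonneg _) zero_le_one).trans_eq (one_mul _)
  have hA₄ : ‖A₄‖ ≤ 3 := by
    rw [hA₄def, norm_mul, h9i]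
    have hBC : ‖(a₁ ^ 2 + a₂) - C‖ ≤ 1 / 3 := by
      rw [show (a₁ ^ 2 + a₂) - C = -(C - (a₁ ^ 2 + 4 * a₂)) - 3 * a₂ by ring]
      refine (norm_sub_le_max₃ _ _).trans (max_le (by rw [norm_neg]; exact hCb) ?_)
      rw [norm_mul, h3n]
      calc (1 / 3 : ℝ) * ‖a₂‖ ≤ (1 / 3) * 1 := by gcongr
        _ = 1 / 3 := mul_one _
    have hin : ‖((a₁ ^ 2 + a₂) - C) ^ 2 + 3 * (a₁ ^ 2 + a₂) * C - 39 / 40 * C ^ 2 -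
        3 * a₁ ^ 2 * (a₁ ^ 2 + a₂) - 6 * a₂ * (a₁ ^ 2 + a₂) - 9 * a₁ ^ 2 * a₂ / 4‖ ≤ 1 / 3 := by
      refine (norm_sub_le_max₃ _ _).trans (max_le ((norm_sub_le_max₃ _ _).trans (max_le
        ((norm_sub_le_max₃ _ _).trans (max_le ((norm_sub_le_max₃ _ _).trans (max_le
        ((norm_add_le_max _ _).trans (max_le ?_ ?_)) ?_)) ?_)) ?_)) ?_)
      · rw [norm_pow]
        calc ‖(a₁ ^ 2 + a₂) - C‖ ^ 2 ≤ (1 / 3) ^ 2 := by gcongr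
          _ ≤ 1 / 3 := by norm_num
      · rw [norm_mul, norm_mul, h3n, hC, mul_one]
        calc (1 / 3 : ℝ) * ‖a₁ ^ 2 + a₂‖ ≤ (1 / 3) * 1 := by gcongr
          _ = 1 / 3 := mul_one _
      · rw [norm_mul, norm_pow, hC, one_pow, mul_one]; exact h39
      · rw [norm_mul, norm_mul, h3n, norm_pow]
        calc (1 / 3 : ℝ) * ‖a₁‖ ^ 2 * ‖a₁ ^ 2 + a₂‖ ≤ (1 / 3) * 1 ^ 2 * 1 := by gcongr
          _ = 1 / 3 := by norm_num
      · rw [norm_mul, norm_mul]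
        calc ‖(6 : ℚ_[3])‖ * ‖a₂‖ * ‖a₁ ^ 2 + a₂‖ ≤ (1 / 3) * 1 * 1 := by gcongr
          _ = 1 / 3 := by norm_num
      · rw [norm_div, h4n, div_one, norm_mul, norm_mul, norm_pow]
        calc ‖(9 : ℚ_[3])‖ * ‖a₁‖ ^ 2 * ‖a₂‖ ≤ (1 / 3) * 1 ^ 2 * 1 := by gcongr
          _ = 1 / 3 := by norm_num
    refine (mul_le_mul_of_nonneg_left hin (by norm_num)).trans ?_
    norm_num
  have hP₅ : ‖P₅‖ ≤ 9 := by
    rw [hP₅def]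
    refine (norm_sub_le_max₃ _ _).trans (max_le ?_ ?_)
    · rw [norm_neg, norm_mul, norm_pow]
      calc ‖a₁‖ * ‖β‖ ^ 2 ≤ 1 * 3 ^ 2 := by gcongr
        _ = 9 := by norm_num
    · rw [norm_mul, norm_mul]
      calc ‖a₁‖ * ‖a₂‖ * ‖β‖ ≤ 1 * 1 * 3 := by gcongr
        _ ≤ 9 := by norm_num
  have hP₆ : ‖P₆‖ ≤ 9 := by
    rw [hP₆def, norm_neg, norm_mul, norm_pow]
    calc ‖a₂‖ * ‖β‖ ^ 2 ≤ 1 * 3 ^ 2 := by gcongr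
      _ = 9 := by norm_num
  refine (norm_add_le_max _ _).trans (max_le ((norm_add_le_max _ _).trans (max_le
    ((norm_add_le_max _ _).trans (max_le ?_ ?_)) ?_)) ?_)
  · rw [norm_mul, norm_pow]
    calc ‖A₃‖ * ‖z‖ ^ 3 ≤ 1 * ‖z‖ ^ 3 := by gcongr
      _ ≤ ‖z‖ ^ 2 / 3 := by rw [one_mul]; exact hr3
  · rw [norm_mul, norm_pow]
    calc ‖A₄‖ * ‖z‖ ^ 4 ≤ 3 * ‖z‖ ^ 4 := by gcongr
      _ ≤ ‖z‖ ^ 2 / 3 := hr4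
  · rw [norm_mul, norm_pow]
    calc ‖P₅‖ * ‖z‖ ^ 5 ≤ 9 * ‖z‖ ^ 5 := by gcongr
      _ ≤ ‖z‖ ^ 2 / 3 := hr5
  · rw [norm_mul, norm_pow]
    calc ‖P₆‖ * ‖z‖ ^ 6 ≤ 9 * ‖z‖ ^ 6 := by gcongr
      _ ≤ ‖z‖ ^ 2 / 3 := hr6

/-- **The analytic core of the second-order law.** With `π = −a₁z − a₂z² + ρ₃` (`‖ρ₃‖ ≤ ‖z‖³`: the
equation to third order), `σ = ½a₁z + ⅓(a₁²+a₂)z² + τ/z` (`‖τ‖ ≤ ‖z‖⁴`: the formal logarithm to third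
order), `‖C‖ = 1`, `C ≡ b₂ (mod 3)` and `0 < ‖z‖ ≤ 3⁻¹`:
`‖(1+π)(1+σ)²·(1 + (Cz²/12)(1+σ)² + (C²z⁴/360)(1+σ)⁴) − 1 − ((C − b₂)/12)z²‖ ≤ ‖z‖²/3`.
Reduction to `second_order_poly_bound`: `(1+π)(1+σ)² = P + O(r³)`,
`(1+π)(1+σ)⁴ = 1 + a₁z + 4βz² + O(r²)`, `(1+π)(1+σ)⁶ = 1 + O(r)`, with `‖Cz²/12‖ = 3r²`,
`‖C²z⁴/360‖ = 9r⁴`. [folklore] -/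
theorem second_order_core_bound {a₁ a₂ C z π σ τ ρ₃ : ℚ_[3]} (ha1 : ‖a₁‖ ≤ 1) (ha2 : ‖a₂‖ ≤ 1)
    (hC : ‖C‖ = 1) (hCb : ‖C - (a₁ ^ 2 + 4 * a₂)‖ ≤ 1 / 3) (hz0 : z ≠ 0) (hzz : 0 < ‖z‖)
    (hz3 : ‖z‖ ≤ 1 / 3) (hπ_eq : π = -(a₁ * z) - a₂ * z ^ 2 + ρ₃) (hρ₃ : ‖ρ₃‖ ≤ ‖z‖ ^ 3)
    (hσ_eq : σ = (2 : ℚ_[3])⁻¹ * a₁ * z + (3 : ℚ_[3])⁻¹ * (a₁ ^ 2 + a₂) * z ^ 2 + τ / z)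
    (hτ : ‖τ‖ ≤ ‖z‖ ^ 4) :
    ‖(1 + π) * (1 + σ) ^ 2 * (1 + (12 : ℚ_[3])⁻¹ * C * z ^ 2 * (1 + σ) ^ 2 +
        (360 : ℚ_[3])⁻¹ * C ^ 2 * z ^ 4 * (1 + σ) ^ 4) - 1 - (C - (a₁ ^ 2 + 4 * a₂)) / 12 * z ^ 2‖
      ≤ ‖z‖ ^ 2 / 3 := by
  obtain ⟨hz1, hz2le1, hz29, hz2lt, h3z2, hr3, hr4, hr5, hr6⟩ := second_order_numerics ‖z‖ hzz hz3
  obtain ⟨hr3le1, hr3le2, hr2d3, hr3one⟩ := second_order_numerics' ‖z‖ hzz hz3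
  obtain ⟨h2n, h4n, h3n, h3i, h9i, h12i, h360i, h6, -, -⟩ := padic_three_constants
  set α : ℚ_[3] := (2 : ℚ_[3])⁻¹ * a₁ with hαdef
  set β : ℚ_[3] := (3 : ℚ_[3])⁻¹ * (a₁ ^ 2 + a₂) with hβdef
  have hα : ‖α‖ ≤ 1 := by rw [hαdef, norm_mul, norm_inv, h2n, inv_one, one_mul]; exact ha1
  have ha12 : ‖a₁ ^ 2 + a₂‖ ≤ 1 :=
    (norm_add_le_max _ _).trans (max_le (by rw [norm_pow]; exact pow_le_one₀ (norm_nonneg _) ha1) ha2)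
  have hβ : ‖β‖ ≤ 3 := by
    rw [hβdef, norm_mul, h3i]
    calc 3 * ‖a₁ ^ 2 + a₂‖ ≤ 3 * 1 := by gcongr
      _ = 3 := mul_one _
  have hτz : ‖τ / z‖ ≤ ‖z‖ ^ 3 := by
    rw [norm_div, div_le_iff₀ hzz]
    calc ‖τ‖ ≤ ‖z‖ ^ 4 := hτ
      _ = ‖z‖ ^ 3 * ‖z‖ := by ring
  have hπ : ‖π‖ ≤ ‖z‖ := by
    rw [hπ_eq]
    refine (norm_add_le_max _ _).trans (max_le ((norm_sub_le_max₃ _ _).trans (max_le ?_ ?_))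
      (hρ₃.trans hr3le1))
    · rw [norm_neg, norm_mul]
      calc ‖a₁‖ * ‖z‖ ≤ 1 * ‖z‖ := by gcongr
        _ = ‖z‖ := one_mul _
    · rw [norm_mul, norm_pow]
      calc ‖a₂‖ * ‖z‖ ^ 2 ≤ 1 * ‖z‖ ^ 2 := by gcongr
        _ ≤ ‖z‖ := by rw [one_mul]; exact hz2lt.le
  have hσ : ‖σ‖ ≤ ‖z‖ := by
    rw [hσ_eq]
    refine (norm_add_le_max _ _).trans (max_le ((norm_add_le_max _ _).trans (max_le ?_ ?_))
      (hτz.trans hr3le1))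
    · rw [norm_mul]
      calc ‖α‖ * ‖z‖ ≤ 1 * ‖z‖ := by gcongr
        _ = ‖z‖ := one_mul _
    · rw [norm_mul, norm_pow]
      calc ‖β‖ * ‖z‖ ^ 2 ≤ 3 * ‖z‖ ^ 2 := by gcongr
        _ ≤ ‖z‖ := h3z2
  have hσ1 : ‖σ‖ ≤ 1 := hσ.trans hz1
  have h1π : ‖1 + π‖ ≤ 1 := (norm_add_le_max _ _).trans (max_le (by simp) (hπ.trans hz1))
  have h1σ : ‖1 + σ‖ ≤ 1 := (norm_add_le_max _ _).trans (max_le (by simp) hσ1)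
  -- the three perturbation terms
  set lam : ℚ_[3] := (12 : ℚ_[3])⁻¹ * C * z ^ 2 with hlamdef
  set mu : ℚ_[3] := (360 : ℚ_[3])⁻¹ * C ^ 2 * z ^ 4 with hmudef
  have hlam : ‖lam‖ = 3 * ‖z‖ ^ 2 := by rw [hlamdef, norm_mul, norm_mul, h12i, hC, norm_pow, mul_one]
  have hmu : ‖mu‖ = 9 * ‖z‖ ^ 4 := by
    rw [hmudef, norm_mul, norm_mul, h360i, norm_pow, hC, one_pow, mul_one, norm_pow]
  -- (T0) `(1+π)(1+σ)² = P + O(r³)`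
  set S : ℚ_[3] := 1 + α * z + β * z ^ 2 with hSdef
  have hSn : ‖S‖ ≤ 1 := by
    rw [hSdef]
    refine (norm_add_le_max _ _).trans (max_le ((norm_add_le_max _ _).trans (max_le (by simp) ?_)) ?_)
    · rw [norm_mul]
      calc ‖α‖ * ‖z‖ ≤ 1 * 1 := by gcongr
        _ = 1 := one_mul _
    · rw [norm_mul, norm_pow]
      calc ‖β‖ * ‖z‖ ^ 2 ≤ 3 * ‖z‖ ^ 2 := by gcongr
        _ ≤ 1 := h3z2.trans hz1
  set P : ℚ_[3] := (1 - a₁ * z - a₂ * z ^ 2) * S ^ 2 with hPdef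
  have hT0 : ‖(1 + π) * (1 + σ) ^ 2 - P‖ ≤ ‖z‖ ^ 3 := by
    have e : (1 + π) * (1 + σ) ^ 2 - P = ρ₃ * S ^ 2 + (1 + π) * (2 * S * (τ / z) + (τ / z) ^ 2) := by
      rw [hσ_eq, hPdef, hSdef, hπ_eq, hαdef, hβdef]
      ring
    rw [e]
    refine (norm_add_le_max _ _).trans (max_le ?_ ?_)
    · rw [norm_mul, norm_pow]
      calc ‖ρ₃‖ * ‖S‖ ^ 2 ≤ ‖z‖ ^ 3 * 1 ^ 2 := by gcongr
        _ = ‖z‖ ^ 3 := by ring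
    · rw [norm_mul]
      have hin : ‖2 * S * (τ / z) + (τ / z) ^ 2‖ ≤ ‖z‖ ^ 3 := by
        refine (norm_add_le_max _ _).trans (max_le ?_ ?_)
        · rw [norm_mul, norm_mul, h2n, one_mul]
          calc ‖S‖ * ‖τ / z‖ ≤ 1 * ‖z‖ ^ 3 := by gcongr
            _ = ‖z‖ ^ 3 := one_mul _
        · rw [norm_pow]
          calc ‖τ / z‖ ^ 2 ≤ (‖z‖ ^ 3) ^ 2 := by gcongr
            _ = ‖z‖ ^ 3 * ‖z‖ ^ 3 := by ring
            _ ≤ ‖z‖ ^ 3 * 1 := by gcongr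
            _ = ‖z‖ ^ 3 := mul_one _
      calc ‖1 + π‖ * ‖2 * S * (τ / z) + (τ / z) ^ 2‖ ≤ 1 * ‖z‖ ^ 3 := by gcongr
        _ = ‖z‖ ^ 3 := one_mul _
  -- (T1) `(1+π)(1+σ)⁴ = 1 + a₁z + 4βz² + O(r²)`
  have hpow4 : ‖(1 + σ) ^ 4 - 1‖ ≤ ‖z‖ := by
    rw [show (1 + σ) ^ 4 - 1 = σ * (4 + 6 * σ + 4 * σ ^ 2 + σ ^ 3) by ring, norm_mul]
    have hin : ‖4 + 6 * σ + 4 * σ ^ 2 + σ ^ 3‖ ≤ 1 := by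
      refine (norm_add_le_max _ _).trans (max_le ((norm_add_le_max _ _).trans (max_le
        ((norm_add_le_max _ _).trans (max_le h4n.le ?_)) ?_)) ?_)
      · rw [norm_mul]
        calc ‖(6 : ℚ_[3])‖ * ‖σ‖ ≤ (1 / 3) * 1 := by gcongr
          _ ≤ 1 := by norm_num
      · rw [norm_mul, h4n, one_mul, norm_pow]; exact pow_le_one₀ (norm_nonneg _) hσ1
      · rw [norm_pow]; exact pow_le_one₀ (norm_nonneg _) hσ1
    calc ‖σ‖ * ‖4 + 6 * σ + 4 * σ ^ 2 + σ ^ 3‖ ≤ ‖z‖ * 1 := by gcongr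
      _ = ‖z‖ := mul_one _
  set E' : ℚ_[3] := (1 + π) * (1 + σ) ^ 4 - 1 - a₁ * z - 4 * β * z ^ 2 with hE'def
  have hE' : ‖E'‖ ≤ ‖z‖ ^ 2 := by
    have e : E' = 4 * (τ / z) + σ ^ 2 * (6 + 4 * σ + σ ^ 2) + (-(a₂ * z ^ 2) + ρ₃) +
        π * ((1 + σ) ^ 4 - 1) := by
      have h2α : (2 : ℚ_[3]) * ((2 : ℚ_[3])⁻¹ * a₁) = a₁ := by field_simp
      rw [hE'def, hβdef]
      linear_combination (4 : ℚ_[3]) * hσ_eq + (2 * z) * h2α + hπ_eq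
    rw [e]
    refine (norm_add_le_max _ _).trans (max_le ((norm_add_le_max _ _).trans (max_le
      ((norm_add_le_max _ _).trans (max_le ?_ ?_)) ?_)) ?_)
    · rw [norm_mul, h4n, one_mul]; exact hτz.trans hr3le2
    · rw [norm_mul, norm_pow]
      have hin : ‖6 + 4 * σ + σ ^ 2‖ ≤ 1 := by
        refine (norm_add_le_max _ _).trans (max_le ((norm_add_le_max _ _).trans (max_le
          (h6.trans (by norm_num)) ?_)) ?_)
        · rw [norm_mul, h4n, one_mul]; exact hσ1
        · rw [norm_pow]; exact pow_le_one₀ (norm_nonneg _) hσ1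
      calc ‖σ‖ ^ 2 * ‖6 + 4 * σ + σ ^ 2‖ ≤ ‖z‖ ^ 2 * 1 := by gcongr
        _ = ‖z‖ ^ 2 := mul_one _
    · refine (norm_add_le_max _ _).trans (max_le ?_ (hρ₃.trans hr3le2))
      rw [norm_neg, norm_mul, norm_pow]
      calc ‖a₂‖ * ‖z‖ ^ 2 ≤ 1 * ‖z‖ ^ 2 := by gcongr
        _ = ‖z‖ ^ 2 := one_mul _
    · rw [norm_mul]
      calc ‖π‖ * ‖(1 + σ) ^ 4 - 1‖ ≤ ‖z‖ * ‖z‖ := by gcongr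
        _ = ‖z‖ ^ 2 := by ring
  -- (T2) `(1+π)(1+σ)⁶ = 1 + O(r)`
  have hT2 : ‖(1 + π) * (1 + σ) ^ 6 - 1‖ ≤ ‖z‖ := by
    have hp6 : ‖(1 + σ) ^ 6 - 1‖ ≤ ‖z‖ := by
      rw [show (1 + σ) ^ 6 - 1 = ((1 + σ) ^ 4 - 1) * (1 + σ) ^ 2 + σ * (2 + σ) by ring]
      refine (norm_add_le_max _ _).trans (max_le ?_ ?_)
      · rw [norm_mul, norm_pow]
        calc ‖(1 + σ) ^ 4 - 1‖ * ‖1 + σ‖ ^ 2 ≤ ‖z‖ * 1 ^ 2 := by gcongr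
          _ = ‖z‖ := by ring
      · rw [norm_mul]
        have h2σ : ‖2 + σ‖ ≤ 1 := (norm_add_le_max _ _).trans (max_le h2n.le hσ1)
        calc ‖σ‖ * ‖2 + σ‖ ≤ ‖z‖ * 1 := by gcongr
          _ = ‖z‖ := mul_one _
    rw [show (1 + π) * (1 + σ) ^ 6 - 1 = π * (1 + σ) ^ 6 + ((1 + σ) ^ 6 - 1) by ring]
    refine (norm_add_le_max _ _).trans (max_le ?_ hp6)
    rw [norm_mul, norm_pow]
    calc ‖π‖ * ‖1 + σ‖ ^ 6 ≤ ‖z‖ * 1 ^ 6 := by gcongr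
      _ = ‖z‖ := by ring
  -- assembly
  have hpoly := second_order_poly_bound ha1 ha2 hC hCb hzz hz3
  have e : (1 + π) * (1 + σ) ^ 2 * (1 + (12 : ℚ_[3])⁻¹ * C * z ^ 2 * (1 + σ) ^ 2 +
        (360 : ℚ_[3])⁻¹ * C ^ 2 * z ^ 4 * (1 + σ) ^ 4) - 1 - (C - (a₁ ^ 2 + 4 * a₂)) / 12 * z ^ 2 =
      ((1 + π) * (1 + σ) ^ 2 - P) + lam * E' + mu * ((1 + π) * (1 + σ) ^ 6 - 1) +
      ((1 - a₁ * z - a₂ * z ^ 2) * (1 + (2 : ℚ_[3])⁻¹ * a₁ * z + (3 : ℚ_[3])⁻¹ * (a₁ ^ 2 + a₂) *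
        z ^ 2) ^ 2 + (12 : ℚ_[3])⁻¹ * C * z ^ 2 * (1 + a₁ * z + 4 * ((3 : ℚ_[3])⁻¹ * (a₁ ^ 2 + a₂)) *
        z ^ 2) + (360 : ℚ_[3])⁻¹ * C ^ 2 * z ^ 4 - 1 - (C - (a₁ ^ 2 + 4 * a₂)) / 12 * z ^ 2) := by
    rw [hPdef, hSdef, hE'def, hlamdef, hmudef, hαdef, hβdef]; ring
  rw [e]
  refine (norm_add_le_max _ _).trans (max_le ((norm_add_le_max _ _).trans (max_le
    ((norm_add_le_max _ _).trans (max_le (hT0.trans hr3) ?_)) ?_)) hpoly)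
  · rw [norm_mul, hlam]
    calc 3 * ‖z‖ ^ 2 * ‖E'‖ ≤ 3 * ‖z‖ ^ 2 * ‖z‖ ^ 2 := by gcongr
      _ = 3 * ‖z‖ ^ 4 := by ring
      _ ≤ ‖z‖ ^ 2 / 3 := hr4
  · rw [norm_mul, hmu]
    calc 9 * ‖z‖ ^ 4 * ‖(1 + π) * (1 + σ) ^ 6 - 1‖ ≤ 9 * ‖z‖ ^ 4 * ‖z‖ := by gcongr
      _ = 9 * ‖z‖ ^ 5 := by ring
      _ ≤ ‖z‖ ^ 2 / 3 := hr5

end Core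

end Summit.BirchSwinnertonDyer.Rank1Residual.X11b.RegMult.HeightLogNumerator

end
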